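import Literature.NumberTheory.EllipticCurves.HeegnerPointsKolyvaginPairing
import HarnessLib

/-!
# Route `CMKolyvaginAtInertTwo`, crux `CMKolyvaginExactAtInertTwo` (stmt-BirchSwinnertonDyer-24277):
# bottom bits and independence of order-`2` elements (pure algebra for the level-`2^M` descents at `p = 2`)

Seat `bsd-line-cmk2-p1` g7 (cell `bsd-print-cf2`); helper (`--supports stmt-BirchSwinnertonDyer-24277`).
THEOREMS ONLY (pure algebra in an additive commutative group): no definition, no named fact, no `sorry`;
no item is closed; BSD is not proved by this.

At level `2^M` the Čebotarev leaf at `2` (`KolyvaginImageTwo.exists_kolyvaginPrime_gt_two_pow_of_targets`)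
is applied to the ORDER-`2` "bottom bits" `2^j w` of the classes in play (they are `c_*`-fixed whatever
the sign of `w`, and two of them are independent with exponents `1` as soon as they are distinct):

* `exists_two_pow_zsmul_ne_zero_two_zsmul_eq_zero` — `2^k z = 0`, `z ≠ 0` ⟹ some `2^j z` (`j < k`) is
  non-zero and killed by `2`;
* `zsmul_eq_emod_two_zsmul_of_two_zsmul` — `a • z = (a % 2) • z` when `2z = 0`;
* `pow_one_dvd_of_sum_one`, `pow_one_dvd_of_sum_two` — independence with exponents `1` of one non-zero,
  resp. two distinct non-zero, elements killed by `2`, in the shape of the leaf's hypothesis `hind`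
  (g6's `dvd_two_of_sum_one/two` assumed the whole group killed by `2`).

References: [McCallumLMS1991] §3 (independent classes `c_i`, "any relation `∑ a_i c_i = 0` implies
`ord c_i ∣ a_i`"); folklore.
-/

-- single-conjunct summit: `Summit.BirchSwinnertonDyer.BirchSwinnertonDyer.…` repeats the name by design
set_option linter.dupNamespace false
set_option autoImplicit false

namespace Summit.BirchSwinnertonDyer.BirchSwinnertonDyer.Theorems.KolyvaginDescentTwo

/-! ## Bottom bits and independence of order-`2` elements -/

/-- **Bottom bit**: in an additive group, a non-zero `z` with `2^k z = 0` has a multiple `2^j z`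
(`j < k`) which is non-zero and killed by `2`. [folklore] -/
theorem exists_two_pow_zsmul_ne_zero_two_zsmul_eq_zero {G : Type*} [AddCommGroup G] :
    ∀ (k : ℕ) {z : G}, (((2 : ℕ) : ℤ) ^ k) • z = 0 → z ≠ 0 →
      ∃ j < k, (((2 : ℕ) : ℤ) ^ j) • z ≠ 0 ∧ ((2 : ℕ) : ℤ) • ((((2 : ℕ) : ℤ) ^ j) • z) = 0 := by
  intro k
  induction k with
  | zero => intro z hk hz; rw [pow_zero, one_smul] at hk; exact absurd hk hz
  | succ k ih =>
    intro z hk hz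
    by_cases h2 : ((2 : ℕ) : ℤ) • z = 0
    · exact ⟨0, Nat.succ_pos k, by rwa [pow_zero, one_smul], by rwa [pow_zero, one_smul]⟩
    · have hk' : (((2 : ℕ) : ℤ) ^ k) • (((2 : ℕ) : ℤ) • z) = 0 := by
        rw [smul_smul, ← pow_succ, hk]
      obtain ⟨j, hj, hne, h0⟩ := ih hk' h2
      refine ⟨j + 1, by omega, ?_, ?_⟩
      · rwa [pow_succ, ← smul_smul]
      · rwa [pow_succ, ← smul_smul]

/-- `a • z = (a % 2) • z` when `2 z = 0`. [folklore] -/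
theorem zsmul_eq_emod_two_zsmul_of_two_zsmul {G : Type*} [AddCommGroup G] {z : G}
    (h2 : ((2 : ℕ) : ℤ) • z = 0) (a : ℤ) : a • z = (a % 2) • z := by
  obtain ⟨k, hk⟩ : ∃ k : ℤ, a = a % 2 + k * 2 := ⟨a / 2, by omega⟩
  conv_lhs => rw [hk]
  have h2' : (2 : ℤ) • z = 0 := by exact_mod_cast h2
  rw [add_zsmul, mul_zsmul, h2', zsmul_zero, add_zero]

/-- A non-zero element killed by `2` is independent with exponent `1` (family of length `1`). [folklore] -/
theorem pow_one_dvd_of_sum_one {G : Type*} [AddCommGroup G] {x : G} (hx2 : ((2 : ℕ) : ℤ) • x = 0)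
    (hx : x ≠ 0) (a : Fin 1 → ℤ) (ha : ∑ i, a i • ![x] i = 0) :
    ∀ i, (((2 : ℕ) : ℤ) ^ (fun _ : Fin 1 ↦ 1) i) ∣ a i := by
  intro i
  obtain rfl : i = 0 := Subsingleton.elim i 0
  rw [Fin.sum_univ_one, Matrix.cons_val_zero, zsmul_eq_emod_two_zsmul_of_two_zsmul hx2] at ha
  rw [pow_one]
  rcases Int.emod_two_eq_zero_or_one (a 0) with h | h
  · exact_mod_cast Int.dvd_of_emod_eq_zero h
  · rw [h, one_zsmul] at ha; exact absurd ha hx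

/-- Two distinct non-zero elements killed by `2` are independent with exponents `1`. [folklore] -/
theorem pow_one_dvd_of_sum_two {G : Type*} [AddCommGroup G] {u x : G} (hu2 : ((2 : ℕ) : ℤ) • u = 0)
    (hx2 : ((2 : ℕ) : ℤ) • x = 0) (hu : u ≠ 0) (hx : x ≠ 0) (hux : u ≠ x) (a : Fin 2 → ℤ)
    (ha : ∑ i, a i • ![u, x] i = 0) : ∀ i, (((2 : ℕ) : ℤ) ^ (fun _ : Fin 2 ↦ 1) i) ∣ a i := by
  have hnegx : -x = x := by
    have h : (2 : ℤ) • x = 0 := by exact_mod_cast hx2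
    rw [two_zsmul] at h
    exact neg_eq_of_add_eq_zero_left h
  rw [Fin.sum_univ_two, Matrix.cons_val_zero, Matrix.cons_val_one, Matrix.cons_val_zero,
    zsmul_eq_emod_two_zsmul_of_two_zsmul hu2 (a 0), zsmul_eq_emod_two_zsmul_of_two_zsmul hx2 (a 1)]
    at ha
  have key : a 0 % 2 = 0 ∧ a 1 % 2 = 0 := by
    rcases Int.emod_two_eq_zero_or_one (a 0) with h0 | h0 <;>
      rcases Int.emod_two_eq_zero_or_one (a 1) with h1 | h1 <;> rw [h0, h1] at ha
    · exact ⟨h0, h1⟩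
    · rw [zero_zsmul, one_zsmul, zero_add] at ha; exact absurd ha hx
    · rw [one_zsmul, zero_zsmul, add_zero] at ha; exact absurd ha hu
    · rw [one_zsmul, one_zsmul, add_eq_zero_iff_eq_neg, hnegx] at ha; exact absurd ha hux
  intro i
  fin_cases i
  · simpa using Int.dvd_of_emod_eq_zero key.1
  · simpa using Int.dvd_of_emod_eq_zero key.2


end Summit.BirchSwinnertonDyer.BirchSwinnertonDyer.Theorems.KolyvaginDescentTwo
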